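import Mathlib.MeasureTheory.Measure.Lebesgue.EqHaar
import Mathlib.MeasureTheory.Integral.Bochner.Set
import Mathlib.Analysis.SpecialFunctions.Pow.Real
import Literature.Analysis.FluidPDE.SelfSimilarEulerProfile
import HarnessLib

/-!
# `L¹` growth of the pressure gradient of a self-similar Euler profile with energy budgets

Analysis/FluidPDE proof file (theorems only; no definitions, no named facts); companion of
`SelfSimilarEulerProfile` (the structure `IsSelfSimilarEulerProfile γ c U P`: the profile
equation `(1 − γ)U + DU[γ(y − c) + U] + ∇P = 0`, `div U = 0`, of self-similar solutions of the
incompressible Euler equations; Constantin–Ignatova–Vicol 2026 (3.3); energy budgets as in Bronzi–Shvydkoy 2015).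

**The estimate.** Let `(V, P)` be a `C²/C¹` self-similar Euler profile on `ℝ³` with exponent
`γ = 1/(2+ρ)`, centre `0`, and suppose the two ENERGY BUDGETS of the power-gauge class:
the `E`-budget `∫ ‖DV‖² ‖y‖^{ρ−1} < ∞` and the velocity budget `∫_{B_R} ‖V‖² ≤ A R^{1−2ρ}`
(`R ≥ 1`). If `−2 ≤ ρ ≤ 1` then there is `D` with

  `∫_{B_R} ‖∇P‖ ≤ D R^{3 − ρ/2}`  for all `R ≥ 1`.

Proof (Cauchy–Schwarz in the elementary `ab ≤ (ta² + t⁻¹b²)/2` form with scale-balanced `t`):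
from the profile equation `‖∇P‖ ≤ |1−γ|‖V‖ + |γ|R‖DV‖ + ‖DV‖‖V‖` on `B_R`; with
`t₁ = R^{1+ρ}`, `t₂ = R^{1+ρ/2}`, `t₃ = R^{ρ/2}` the three terms cost
`R^{2−ρ}`, `R^{3−ρ/2}`, `R^{1−3ρ/2}` — all `≤ R^{3−ρ/2}` exactly when `ρ ≥ −2` — using
`∫_{B_R} ‖DV‖² ≤ R^{1−ρ} ∫ ‖DV‖²‖y‖^{ρ−1}` (the weight `‖y‖^{ρ−1} ≥ R^{ρ−1}` on `B_R`, `ρ ≤ 1`)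
and `|B_R| = R³|B₁|`.

This is piece S2 `GradPressureL1Growth ρ` of the `ns` instrument «pressure budget with a
logarithm» (nsreg cell, 2026-08-29, typed text `Sketch58c`), stated over the Literature structure
with the budgets unfolded verbatim and the range binder `−2 ≤ ρ` OUTSIDE (the typed Prop carries
`ρ ≤ 1` inside; for `ρ < −2` the exponent `3 − ρ/2` is not the maximum of the three).

## Contents

* `IsSelfSimilarEulerProfile.norm_gradient_pressure_le` — pointwise `‖∇P‖ ≤ |1−γ|‖U‖ + ‖DU‖(|γ|‖y − c‖ + ‖U‖)`
  (any inner product space);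
* `IsSelfSimilarEulerProfile.exists_integral_ball_norm_gradient_pressure_le` — the estimate.

## References

* P. Constantin, M. Ignatova, V. Vicol, *On putative self-similarity for incompressible 3D
  Euler*, arXiv:2602.17570 (2026), §3.1.1 eq. (3.3) (the profile equation, the source of the
  structure `IsSelfSimilarEulerProfile`). [`ConstantinIgnatovaVicol2026Putative`]
* A. Bronzi, R. Shvydkoy, *On the energy behavior of locally self-similar blowup for the Euler
  equation*, Indiana Univ. Math. J. 64 (2015) (power-gauge energy budgets of self-similar
  profiles). [`BronziShvydkoy2015`]
-/

noncomputable section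

open MeasureTheory Metric Set Filter
open scoped ENNReal NNReal

namespace Literature.Analysis.FluidPDE

namespace IsSelfSimilarEulerProfile

variable {E : Type*} [NormedAddCommGroup E] [InnerProductSpace ℝ E] [FiniteDimensional ℝ E]

/-- **Pointwise bound for the pressure gradient of a self-similar Euler profile** (from the
profile equation `∇P = −(1−γ)U − DU[γ(y − c) + U]`):
`‖∇P(y)‖ ≤ |1−γ|‖U y‖ + ‖DU y‖ (|γ|‖y − c‖ + ‖U y‖)`. [cite: ConstantinIgnatovaVicol2026Putative, §3.1.1 eq. (3.3)] -/
theorem norm_gradient_pressure_le {γ : ℝ} {c : E} {U : E → E} {P : E → ℝ}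
    (h : IsSelfSimilarEulerProfile γ c U P) (y : E) :
    ‖gradient P y‖ ≤ |1 - γ| * ‖U y‖ + ‖fderiv ℝ U y‖ * (|γ| * ‖y - c‖ + ‖U y‖) := by
  have e := h.profile_eq y
  have hP : gradient P y = -((1 - γ) • U y + fderiv ℝ U y (γ • (y - c) + U y)) := by
    rw [eq_neg_iff_add_eq_zero, add_comm]
    exact e
  rw [hP, norm_neg]
  calc ‖(1 - γ) • U y + fderiv ℝ U y (γ • (y - c) + U y)‖
      ≤ ‖(1 - γ) • U y‖ + ‖fderiv ℝ U y (γ • (y - c) + U y)‖ := norm_add_le _ _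
    _ ≤ |1 - γ| * ‖U y‖ + ‖fderiv ℝ U y‖ * (|γ| * ‖y - c‖ + ‖U y‖) := by
        gcongr
        · rw [norm_smul, Real.norm_eq_abs]
        · calc ‖fderiv ℝ U y (γ • (y - c) + U y)‖
              ≤ ‖fderiv ℝ U y‖ * ‖γ • (y - c) + U y‖ := ContinuousLinearMap.le_opNorm _ _
            _ ≤ ‖fderiv ℝ U y‖ * (|γ| * ‖y - c‖ + ‖U y‖) := by
                gcongr
                calc ‖γ • (y - c) + U y‖ ≤ ‖γ • (y - c)‖ + ‖U y‖ := norm_add_le _ _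
                  _ = |γ| * ‖y - c‖ + ‖U y‖ := by rw [norm_smul, Real.norm_eq_abs]

/-- Weighted arithmetic–geometric mean: `ab ≤ (t a² + t⁻¹ b²)/2` for `t > 0`. [folklore] -/
private theorem mul_le_weighted_sq_add_sq {a b t : ℝ} (ht : 0 < t) :
    a * b ≤ (t * a ^ 2 + t⁻¹ * b ^ 2) / 2 := by
  have hk : 0 ≤ (t * a - b) ^ 2 / t := by positivity
  have hexp : (t * a - b) ^ 2 / t = t * a ^ 2 + t⁻¹ * b ^ 2 - 2 * (a * b) := by
    field_simp
    ring
  rw [hexp] at hk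
  linarith

/-- **`L¹` growth of the pressure gradient of a self-similar Euler profile under the energy
budgets** (piece S2 of the `ns` «pressure budget with a logarithm»): for a self-similar Euler
profile `(V, P)` on `ℝ³` with exponent `γ = 1/(2+ρ)`, centre `0`, `−2 ≤ ρ ≤ 1`, the `E`-budget
`∫ ‖DV‖² ‖y‖^{ρ−1} < ∞` and the velocity budget `∫_{B_R}‖V‖² ≤ A R^{1−2ρ}` (`R ≥ 1`), there is
`D` with `∫_{B_R} ‖∇P‖ ≤ D R^{3−ρ/2}` for all `R ≥ 1` (profile equation, weighted AM–GM with the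
scale-balanced weights `R^{1+ρ}`, `R^{1+ρ/2}`, `R^{ρ/2}`, `∫_{B_R}‖DV‖² ≤ R^{1−ρ}·E`,
`|B_R| = R³|B₁|`; the three contributions `R^{2−ρ}, R^{3−ρ/2}, R^{1−3ρ/2}` are `≤ R^{3−ρ/2}` for
`ρ ≥ −2`). [cite: ConstantinIgnatovaVicol2026Putative, §3.1.1 eq. (3.3)] -/
theorem exists_integral_ball_norm_gradient_pressure_le {ρ : ℝ} (hρ2 : -2 ≤ ρ) (hρ1 : ρ ≤ 1)
    {V : EuclideanSpace ℝ (Fin 3) → EuclideanSpace ℝ (Fin 3)} {P : EuclideanSpace ℝ (Fin 3) → ℝ}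
    (h : IsSelfSimilarEulerProfile (1 / (2 + ρ)) 0 V P)
    (hE : (∫⁻ y, ‖fderiv ℝ V y‖ₑ ^ 2 * ENNReal.ofReal (‖y‖ ^ (ρ - 1))) ≠ ⊤)
    (hV : ∃ A : ℝ, ∀ R : ℝ, 1 ≤ R →
      ∫ y in ball (0 : EuclideanSpace ℝ (Fin 3)) R, ‖V y‖ ^ 2 ≤ A * R ^ (1 - 2 * ρ)) :
    ∃ D : ℝ, ∀ R : ℝ, 1 ≤ R →
      ∫ y in ball (0 : EuclideanSpace ℝ (Fin 3)) R, ‖gradient P y‖ ≤ D * R ^ (3 - ρ / 2) := by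
  obtain ⟨A, hA⟩ := hV
  set γ : ℝ := 1 / (2 + ρ) with hγ
  set L : ℝ≥0∞ := ∫⁻ y, ‖fderiv ℝ V y‖ₑ ^ 2 * ENNReal.ofReal (‖y‖ ^ (ρ - 1)) with hL
  set Eb : ℝ := L.toReal with hEb
  set c : ℝ := (volume (ball (0 : EuclideanSpace ℝ (Fin 3)) 1)).toReal with hc
  have hEb0 : 0 ≤ Eb := ENNReal.toReal_nonneg
  have hc0 : 0 ≤ c := ENNReal.toReal_nonneg
  have hA0 : 0 ≤ A := by
    have h1 := hA 1 le_rfl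
    rw [Real.one_rpow, mul_one] at h1
    exact (integral_nonneg fun y => by positivity).trans h1
  -- continuity of the fields
  have hVc : Continuous V := h.contDiff_velocity.continuous
  have hDVc : Continuous (fderiv ℝ V) := h.contDiff_velocity.continuous_fderiv (by norm_num)
  -- the constant
  refine ⟨|1 - γ| / 2 * A + 2⁻¹ * A + |γ| / 2 * Eb + 2⁻¹ * Eb + |1 - γ| / 2 * c + |γ| / 2 * c,
    fun R hR1 => ?_⟩
  have hR : 0 < R := one_pos.trans_le hR1
  -- the scale-balanced weights
  set t₁ : ℝ := R ^ (1 + ρ) with ht₁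
  set t₂ : ℝ := R ^ (1 + ρ / 2) with ht₂
  set t₃ : ℝ := R ^ (ρ / 2) with ht₃
  have ht₁0 : 0 < t₁ := Real.rpow_pos_of_pos hR _
  have ht₂0 : 0 < t₂ := Real.rpow_pos_of_pos hR _
  have ht₃0 : 0 < t₃ := Real.rpow_pos_of_pos hR _
  -- the coefficients of the majorant `α‖V‖² + β‖DV‖² + κ`
  set α : ℝ := |1 - γ| / 2 * t₁ + 2⁻¹ * t₃ with hα
  set β : ℝ := |γ| * R / 2 * t₂ + 2⁻¹ * t₃⁻¹ with hβ
  set κ : ℝ := |1 - γ| / 2 * t₁⁻¹ + |γ| * R / 2 * t₂⁻¹ with hκ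
  have hα0 : 0 ≤ α := by positivity
  have hβ0 : 0 ≤ β := by positivity
  have hκ0 : 0 ≤ κ := by positivity
  -- pointwise majorant on the ball
  have hpt : ∀ y ∈ ball (0 : EuclideanSpace ℝ (Fin 3)) R,
      ‖gradient P y‖ ≤ α * ‖V y‖ ^ 2 + β * ‖fderiv ℝ V y‖ ^ 2 + κ := by
    intro y hy
    have hyR : ‖y‖ ≤ R := (mem_ball_zero_iff.1 hy).le
    have h0 := h.norm_gradient_pressure_le y
    rw [sub_zero] at h0
    have h1 : |1 - γ| * ‖V y‖ ≤ |1 - γ| * ((t₁ * ‖V y‖ ^ 2 + t₁⁻¹ * 1 ^ 2) / 2) := by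
      refine mul_le_mul_of_nonneg_left ?_ (abs_nonneg _)
      have := mul_le_weighted_sq_add_sq (a := ‖V y‖) (b := 1) ht₁0
      rwa [mul_one] at this
    have h2 : ‖fderiv ℝ V y‖ * (|γ| * ‖y‖) ≤ |γ| * R * ((t₂ * ‖fderiv ℝ V y‖ ^ 2 + t₂⁻¹ * 1 ^ 2) / 2) := by
      calc ‖fderiv ℝ V y‖ * (|γ| * ‖y‖) ≤ ‖fderiv ℝ V y‖ * (|γ| * R) := by gcongr
        _ = |γ| * R * (‖fderiv ℝ V y‖ * 1) := by ring
        _ ≤ |γ| * R * ((t₂ * ‖fderiv ℝ V y‖ ^ 2 + t₂⁻¹ * 1 ^ 2) / 2) :=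
            mul_le_mul_of_nonneg_left (mul_le_weighted_sq_add_sq ht₂0) (by positivity)
    have h3 : ‖fderiv ℝ V y‖ * ‖V y‖ ≤ (t₃⁻¹ * ‖fderiv ℝ V y‖ ^ 2 + t₃⁻¹⁻¹ * ‖V y‖ ^ 2) / 2 :=
      mul_le_weighted_sq_add_sq (inv_pos.2 ht₃0)
    rw [inv_inv] at h3
    have hsplit : ‖fderiv ℝ V y‖ * (|γ| * ‖y‖ + ‖V y‖) =
        ‖fderiv ℝ V y‖ * (|γ| * ‖y‖) + ‖fderiv ℝ V y‖ * ‖V y‖ := by ring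
    rw [hsplit] at h0
    have hsum : |1 - γ| * ((t₁ * ‖V y‖ ^ 2 + t₁⁻¹ * 1 ^ 2) / 2) +
        |γ| * R * ((t₂ * ‖fderiv ℝ V y‖ ^ 2 + t₂⁻¹ * 1 ^ 2) / 2) +
        (t₃⁻¹ * ‖fderiv ℝ V y‖ ^ 2 + t₃ * ‖V y‖ ^ 2) / 2 =
        α * ‖V y‖ ^ 2 + β * ‖fderiv ℝ V y‖ ^ 2 + κ := by
      simp only [hα, hβ, hκ]; ring
    linarith
  -- integrability on the ball
  have hK : IsCompact (closedBall (0 : EuclideanSpace ℝ (Fin 3)) R) := isCompact_closedBall _ _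
  have hVi : IntegrableOn (fun y => ‖V y‖ ^ 2) (ball (0 : EuclideanSpace ℝ (Fin 3)) R) volume :=
    ((hVc.norm.pow 2).continuousOn.integrableOn_compact hK).mono_set ball_subset_closedBall
  have hDVi : IntegrableOn (fun y => ‖fderiv ℝ V y‖ ^ 2) (ball (0 : EuclideanSpace ℝ (Fin 3)) R) volume :=
    ((hDVc.norm.pow 2).continuousOn.integrableOn_compact hK).mono_set ball_subset_closedBall
  have hvolR : volume (ball (0 : EuclideanSpace ℝ (Fin 3)) R) = ENNReal.ofReal (R ^ 3) *
      volume (ball (0 : EuclideanSpace ℝ (Fin 3)) 1) := by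
    rw [Measure.addHaar_ball volume (0 : EuclideanSpace ℝ (Fin 3)) hR.le, finrank_euclideanSpace_fin]
  have hvol_top : volume (ball (0 : EuclideanSpace ℝ (Fin 3)) R) ≠ ⊤ := measure_ball_lt_top.ne
  have hvol_real : (volume (ball (0 : EuclideanSpace ℝ (Fin 3)) R)).toReal = R ^ 3 * c := by
    rw [hvolR, ENNReal.toReal_mul, ENNReal.toReal_ofReal (by positivity), hc]
  have hκi : IntegrableOn (fun _ => κ) (ball (0 : EuclideanSpace ℝ (Fin 3)) R) volume :=
    integrableOn_const hvol_top
  have hmaj : IntegrableOn (fun y => α * ‖V y‖ ^ 2 + β * ‖fderiv ℝ V y‖ ^ 2 + κ)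
      (ball (0 : EuclideanSpace ℝ (Fin 3)) R) volume :=
    ((hVi.const_mul α).add (hDVi.const_mul β)).add hκi
  -- the budget for `∫_{B_R} ‖DV‖²`
  have hIDV : ∫ y in ball (0 : EuclideanSpace ℝ (Fin 3)) R, ‖fderiv ℝ V y‖ ^ 2 ≤ R ^ (1 - ρ) * Eb := by
    have hnn : 0 ≤ᵐ[volume.restrict (ball (0 : EuclideanSpace ℝ (Fin 3)) R)]
        fun y => ‖fderiv ℝ V y‖ ^ 2 := ae_of_all _ fun y => by positivity
    rw [integral_eq_lintegral_of_nonneg_ae hnn (hDVc.norm.pow 2).aestronglyMeasurable]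
    have h0 : ∀ᵐ y ∂(volume : Measure (EuclideanSpace ℝ (Fin 3))), y ≠ 0 :=
      compl_mem_ae_iff.2 (measure_singleton 0)
    have key : ∫⁻ y in ball (0 : EuclideanSpace ℝ (Fin 3)) R, ENNReal.ofReal (‖fderiv ℝ V y‖ ^ 2) ≤
        ENNReal.ofReal (R ^ (1 - ρ)) * L := by
      calc ∫⁻ y in ball (0 : EuclideanSpace ℝ (Fin 3)) R, ENNReal.ofReal (‖fderiv ℝ V y‖ ^ 2)
          ≤ ∫⁻ y in ball (0 : EuclideanSpace ℝ (Fin 3)) R, ENNReal.ofReal (R ^ (1 - ρ)) *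
              (‖fderiv ℝ V y‖ₑ ^ 2 * ENNReal.ofReal (‖y‖ ^ (ρ - 1))) := by
            refine setLIntegral_mono_ae' measurableSet_ball ?_
            filter_upwards [h0] with y hy0 hy
            have hyR : ‖y‖ ≤ R := (mem_ball_zero_iff.1 hy).le
            have hy0' : 0 < ‖y‖ := norm_pos_iff.2 hy0
            -- `1 ≤ R^{1-ρ} ‖y‖^{ρ-1}`
            have hw : 1 ≤ R ^ (1 - ρ) * ‖y‖ ^ (ρ - 1) := by
              have h1 : R ^ (ρ - 1) ≤ ‖y‖ ^ (ρ - 1) :=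
                Real.rpow_le_rpow_of_nonpos hy0' hyR (by linarith)
              calc (1 : ℝ) = R ^ (1 - ρ) * R ^ (ρ - 1) := by
                    rw [← Real.rpow_add hR, show (1 - ρ) + (ρ - 1) = 0 by ring, Real.rpow_zero]
                _ ≤ R ^ (1 - ρ) * ‖y‖ ^ (ρ - 1) := by gcongr
            have hsq : ENNReal.ofReal (‖fderiv ℝ V y‖ ^ 2) = ‖fderiv ℝ V y‖ₑ ^ 2 := by
              rw [ENNReal.ofReal_pow (norm_nonneg _), ofReal_norm]
            calc ENNReal.ofReal (‖fderiv ℝ V y‖ ^ 2) = ‖fderiv ℝ V y‖ₑ ^ 2 * ENNReal.ofReal 1 := by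
                  rw [hsq, ENNReal.ofReal_one, mul_one]
              _ ≤ ‖fderiv ℝ V y‖ₑ ^ 2 * ENNReal.ofReal (R ^ (1 - ρ) * ‖y‖ ^ (ρ - 1)) := by
                  gcongr
              _ = ENNReal.ofReal (R ^ (1 - ρ)) * (‖fderiv ℝ V y‖ₑ ^ 2 * ENNReal.ofReal (‖y‖ ^ (ρ - 1))) := by
                  rw [ENNReal.ofReal_mul (by positivity)]; ring
        _ ≤ ∫⁻ y, ENNReal.ofReal (R ^ (1 - ρ)) * (‖fderiv ℝ V y‖ₑ ^ 2 * ENNReal.ofReal (‖y‖ ^ (ρ - 1))) :=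
            setLIntegral_le_lintegral _ _
        _ = ENNReal.ofReal (R ^ (1 - ρ)) * L := by
            rw [lintegral_const_mul' _ _ ENNReal.ofReal_ne_top]
    have htop : ENNReal.ofReal (R ^ (1 - ρ)) * L ≠ ⊤ := ENNReal.mul_ne_top ENNReal.ofReal_ne_top hE
    calc (∫⁻ y in ball (0 : EuclideanSpace ℝ (Fin 3)) R, ENNReal.ofReal (‖fderiv ℝ V y‖ ^ 2)).toReal
        ≤ (ENNReal.ofReal (R ^ (1 - ρ)) * L).toReal := ENNReal.toReal_mono htop key
      _ = R ^ (1 - ρ) * Eb := by rw [ENNReal.toReal_mul, ENNReal.toReal_ofReal (by positivity), hEb]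
  -- integrate the majorant
  have hint : ∫ y in ball (0 : EuclideanSpace ℝ (Fin 3)) R, ‖gradient P y‖ ≤
      α * (A * R ^ (1 - 2 * ρ)) + β * (R ^ (1 - ρ) * Eb) + κ * (R ^ 3 * c) := by
    calc ∫ y in ball (0 : EuclideanSpace ℝ (Fin 3)) R, ‖gradient P y‖
        ≤ ∫ y in ball (0 : EuclideanSpace ℝ (Fin 3)) R, (α * ‖V y‖ ^ 2 + β * ‖fderiv ℝ V y‖ ^ 2 + κ) := by
          refine integral_mono_of_nonneg (ae_of_all _ fun y => norm_nonneg _) hmaj ?_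
          exact (ae_restrict_iff' measurableSet_ball).2 (ae_of_all _ hpt)
      _ = α * (∫ y in ball (0 : EuclideanSpace ℝ (Fin 3)) R, ‖V y‖ ^ 2) +
            β * (∫ y in ball (0 : EuclideanSpace ℝ (Fin 3)) R, ‖fderiv ℝ V y‖ ^ 2) +
            κ * (R ^ 3 * c) := by
          have hsum_i : Integrable (fun y => α * ‖V y‖ ^ 2 + β * ‖fderiv ℝ V y‖ ^ 2)
              (volume.restrict (ball (0 : EuclideanSpace ℝ (Fin 3)) R)) :=
            (hVi.const_mul α).add (hDVi.const_mul β)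
          have hκi' : Integrable (fun _ => κ) (volume.restrict (ball (0 : EuclideanSpace ℝ (Fin 3)) R)) :=
            hκi
          rw [integral_add hsum_i hκi', integral_add (hVi.const_mul α) (hDVi.const_mul β),
            integral_const_mul, integral_const_mul, setIntegral_const, measureReal_def, hvol_real,
            smul_eq_mul, mul_comm (R ^ 3 * c) κ]
      _ ≤ α * (A * R ^ (1 - 2 * ρ)) + β * (R ^ (1 - ρ) * Eb) + κ * (R ^ 3 * c) := by
          gcongr
          · exact hA R hR1
  refine hint.trans ?_
  -- exponent bookkeeping: six monomials, each `≤ R^{3-ρ/2}`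
  have hpow : ∀ a b : ℝ, R ^ a * R ^ b = R ^ (a + b) := fun a b => (Real.rpow_add hR a b).symm
  have hR3 : R ^ (3 : ℕ) = R ^ (3 : ℝ) := by
    rw [← Real.rpow_natCast]; norm_num
  have hle : ∀ e : ℝ, e ≤ 3 - ρ / 2 → R ^ e ≤ R ^ (3 - ρ / 2) := fun e he =>
    Real.rpow_le_rpow_of_exponent_le hR1 he
  have hinv₁ : t₁⁻¹ = R ^ (-(1 + ρ)) := by rw [ht₁, Real.rpow_neg hR.le]
  have hinv₂ : t₂⁻¹ = R ^ (-(1 + ρ / 2)) := by rw [ht₂, Real.rpow_neg hR.le]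
  have hinv₃ : t₃⁻¹ = R ^ (-(ρ / 2)) := by rw [ht₃, Real.rpow_neg hR.le]
  have hRmul : ∀ a : ℝ, R * R ^ a = R ^ (1 + a) := fun a => by
    rw [Real.rpow_add hR, Real.rpow_one]
  have M1 : t₁ * R ^ (1 - 2 * ρ) ≤ R ^ (3 - ρ / 2) := by
    rw [ht₁, hpow]; exact hle _ (by linarith)
  have M2 : t₃ * R ^ (1 - 2 * ρ) ≤ R ^ (3 - ρ / 2) := by
    rw [ht₃, hpow]; exact hle _ (by linarith)
  have M3 : R * t₂ * R ^ (1 - ρ) ≤ R ^ (3 - ρ / 2) := by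
    rw [ht₂, hRmul, hpow]; exact hle _ (by linarith)
  have M4 : t₃⁻¹ * R ^ (1 - ρ) ≤ R ^ (3 - ρ / 2) := by
    rw [hinv₃, hpow]; exact hle _ (by linarith)
  have M5 : t₁⁻¹ * R ^ (3 : ℕ) ≤ R ^ (3 - ρ / 2) := by
    rw [hinv₁, hR3, hpow]; exact hle _ (by linarith)
  have M6 : R * t₂⁻¹ * R ^ (3 : ℕ) ≤ R ^ (3 - ρ / 2) := by
    rw [hinv₂, hR3, hRmul, hpow]; exact hle _ (by linarith)
  have hexp : α * (A * R ^ (1 - 2 * ρ)) + β * (R ^ (1 - ρ) * Eb) + κ * (R ^ 3 * c) =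
      |1 - γ| / 2 * A * (t₁ * R ^ (1 - 2 * ρ)) + 2⁻¹ * A * (t₃ * R ^ (1 - 2 * ρ)) +
      |γ| / 2 * Eb * (R * t₂ * R ^ (1 - ρ)) + 2⁻¹ * Eb * (t₃⁻¹ * R ^ (1 - ρ)) +
      |1 - γ| / 2 * c * (t₁⁻¹ * R ^ (3 : ℕ)) + |γ| / 2 * c * (R * t₂⁻¹ * R ^ (3 : ℕ)) := by
    simp only [hα, hβ, hκ]; ring
  rw [hexp]
  have c1 : 0 ≤ |1 - γ| / 2 * A := by positivity
  have c2 : 0 ≤ 2⁻¹ * A := by positivity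
  have c3 : 0 ≤ |γ| / 2 * Eb := by positivity
  have c4 : 0 ≤ 2⁻¹ * Eb := by positivity
  have c5 : 0 ≤ |1 - γ| / 2 * c := by positivity
  have c6 : 0 ≤ |γ| / 2 * c := by positivity
  have T1 := mul_le_mul_of_nonneg_left M1 c1
  have T2 := mul_le_mul_of_nonneg_left M2 c2
  have T3 := mul_le_mul_of_nonneg_left M3 c3
  have T4 := mul_le_mul_of_nonneg_left M4 c4
  have T5 := mul_le_mul_of_nonneg_left M5 c5
  have T6 := mul_le_mul_of_nonneg_left M6 c6
  linarith

end IsSelfSimilarEulerProfile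

end Literature.Analysis.FluidPDE

end
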